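import Summits.CriticalPhenomena.PercolationContinuityZ3.Theorems.PercNearOneGluingNoHeavyQuantNearRouteCertificate
import HarnessLib

/-!
# QUANT lane R8, T-DEC: the near-route certificate for a GENERAL far-giant piece shape `{lo, lo+K; γ}` — injectivity on CHARGED lows only, and the
# progression criterion on the atoms `lo·j + K·s` for shapes `lo < K`, `2K ≤ 3·lo`, every width `j ≥ 2` (census-1 gen 31, part 2 of the hub programme)

builds on p205010 (kernel theorem, internal audit signed; external expert review pending)

Support file (`--supports stmt-CriticalPhenomena-4575`), QUANT lane seat prim-quant-census-1 (gen 31); memo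
`run/shared/lean/prim/quant/prim-quant-census-1/g31/HUB-GENERAL-G31.md` §3.  Theorems only (no definitions), standard axioms, no sorries.  Generalises
`sdec_of_nearRoutes` / `sdec_progression` (census-1 g31 `…QuantNearRouteCertificate`, the shape `{1,3;γ}` of glued children) to the far-giant piece
`{lo, lo+K; γ}` of the glued sibling `R^lo[q](R^K[g])`: the hub of `j` such pieces lives on the progression `lo·j + K·s`.

* **`sdec_of_nearRoutes_charged`** — as `sdec_of_nearRoutes`, but the route map need only be injective on CHARGED positive lows (`μ l > 0`): an
  uncharged low ships nothing, so its collision with a charged one is harmless.  (Needed because on a progression of step `K ≥ 3` the natural route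
  map is monotone only along the progression.)
* **`sdec_progressionLK`** — THE PROGRESSION CRITERION FOR THE SHAPE `(lo, K)`, `lo < K`, `2K ≤ 3lo`, EVERY width `j ≥ 2`: `μ` a probability law on
  `{0..(lo+K)j}` charging only atoms `lo·j + K·s`, mean `T₀ < (lo+K)j`, floor `x·(lo+K)j ≤ T₀`, a constant `R ≥ 2` with `x(1+R) ≤ R`, and the ROUTE
  BOUND `R·μ l ≤ μ(l + K r)` for every charged `l` with `2l < T₀` and every `r ≥ 1` with `2K(r−1) < 3(T₀ − 2l)` ⟹ `SDEC x ((lo+K)j) μ`.  Route map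
  `l ↦ l + K⌈3(T−2l)/(2K)⌉` (credit gate `≤ 2/3`); NEAR (`h < T`) because `l ≥ lo·j` and `(3lo − K)·j ≥ 2K` — exactly `K ≤ 3lo/2` at `j = 2`, so no
  width needs separate treatment (for `(lo,K) = (1,2)` this inequality forces `j ≥ 4`, whence g30's pair/triple hubs); on the progression the map
  shifts by `−2K` per step (`Nat.ceil_add_nat`), hence injective on charged lows.
Numerics (memo §3, code/exp5.py, kit j290495): hubs of shapes (2,3), (3,4), (4,5), (4,6) are certified cost-free at every width tested; shapes with
`K > 3lo/2` ((1,3), (1,4), (2,5), (2,9)) have width-2/3 hubs whose cost-free LP is infeasible (torque-cost far routes needed there).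

HONEST STATUS.  Certificate infrastructure; `SiblingStep`, `GluedDominated'`, `SDECConvClosed`, `FarTreeRow` OPEN; RATE class (log\*) / honest sentence
of `run/shared/lean/prim/quant/README.md` unchanged.  [this work].  Nothing here is cited as a published result.  The gluing rows served
[cite: KozmaNitzan2024, Conjecture 3 (p. 15)]; product measure [cite: Grimmett1999, §1.3 p. 10].
-/

noncomputable section

open scoped BigOperators

namespace Summit.CriticalPhenomena.PercolationContinuityZ3.Theorems
namespace Quant
namespace LawDec

open Finset

/-- capacity of one route: `θ < 1`, `θ·(A + B) ≤ B` ⟹ `θ/(1−θ)·A ≤ B`. [this work] -/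
private theorem rate_mul_le' {θ A B : ℝ} (hθ1 : θ < 1) (h : θ * (A + B) ≤ B) : θ / (1 - θ) * A ≤ B := by
  rw [div_mul_eq_mul_div, div_le_iff₀ (by linarith)]
  linarith

/-- the mean of a probability law on `{0..M}` is at most `M`. [this work] -/
private theorem mean_le_top_law' (M : ℕ) (μ : ℕ → ℝ) (hμ0 : ∀ h, 0 ≤ μ h) (hμ1 : ∑ h ∈ Finset.range (M + 1), μ h = 1) :
    ∑ h ∈ Finset.range (M + 1), (h : ℝ) * μ h ≤ M := by
  calc ∑ h ∈ Finset.range (M + 1), (h : ℝ) * μ h ≤ ∑ h ∈ Finset.range (M + 1), (M : ℝ) * μ h := by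
        refine Finset.sum_le_sum fun h hh => ?_
        have : (h : ℝ) ≤ M := by exact_mod_cast Nat.lt_succ_iff.1 (Finset.mem_range.1 hh)
        exact mul_le_mul_of_nonneg_right this (hμ0 h)
    _ = M := by rw [← Finset.mul_sum, hμ1, mul_one]

/-! ### One near route per charged low atom -/

/-- **ONE NEAR ROUTE PER CHARGED LOW ATOM ⟹ SDEC** (as `sdec_of_nearRoutes`, with injectivity of the route map required only on the CHARGED positive
lows of each target). [this work] -/
theorem sdec_of_nearRoutes_charged (x T₀ : ℝ) (M : ℕ) (μ : ℕ → ℝ) (t : ℝ → ℕ → ℕ) (hx0 : 0 < x) (hx1 : x < 1)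
    (hμ0 : ∀ h, 0 ≤ μ h) (hμM : ∀ h, M < h → μ h = 0) (hμ1 : ∑ h ∈ Finset.range (M + 1), μ h = 1)
    (hT : ∑ h ∈ Finset.range (M + 1), (h : ℝ) * μ h = T₀) (hT0 : 0 < T₀) (hta : x * (M : ℝ) ≤ T₀)
    (hroute : ∀ T : ℝ, 0 < T → T ≤ T₀ → ∀ l : ℕ, 1 ≤ l → 2 * (l : ℝ) < T → 0 < μ l →
      l < t T l ∧ ((t T l : ℕ) : ℝ) < T ∧ T < (l : ℝ) + (t T l : ℕ) ∧
      max x ((T - 2 * (l : ℝ)) / (((t T l : ℕ) : ℝ) - l)) * (μ l + μ (t T l)) ≤ μ (t T l))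
    (hinj : ∀ T : ℝ, 0 < T → T ≤ T₀ → ∀ l l' : ℕ, 1 ≤ l → 2 * (l : ℝ) < T → 0 < μ l → 1 ≤ l' → 2 * (l' : ℝ) < T → 0 < μ l' →
      t T l = t T l' → l = l') :
    SDEC x M μ := by
  classical
  have hTM : T₀ ≤ M := by rw [← hT]; exact mean_le_top_law' M μ hμ0 hμ1
  intro a ha0 ha1 j' hj'
  obtain ⟨g0, gM, g1⟩ := gate_laws M μ a ha0.le ha1 hμ0 hμM hμ1
  have gmean : ∑ h ∈ Finset.range (M + 1), (h : ℝ) * gate μ a h = a * T₀ := by rw [sum_mul_gate, hT]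
  have gpos : ∀ h : ℕ, h ≠ 0 → gate μ a h = a * μ h := fun h hh => by
    rw [gate_apply, if_neg hh, mul_zero, add_zero]
  set T : ℝ := a * T₀ with hTdef
  set y : ℝ := a * x with hydef
  have hy0 : 0 < y := mul_pos ha0 hx0
  have hyx : y ≤ x := by
    have := mul_le_mul_of_nonneg_right ha1 hx0.le
    rwa [one_mul] at this
  have hy1 : y < 1 := lt_of_le_of_lt hyx hx1
  have hTpos : 0 < T := mul_pos ha0 hT0
  have hTle : T ≤ T₀ := by
    have := mul_le_mul_of_nonneg_right ha1 hT0.le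
    rwa [one_mul] at this
  have hta' : y * (M : ℝ) ≤ T := by
    have := mul_le_mul_of_nonneg_left hta ha0.le
    rw [hydef, hTdef, mul_assoc]; exact this
  rw [decAt_iff_decAtT, gmean]
  refine decAtT_of_flowAtT y T j' M (gate μ a) hy0 hy1 gM g1 ?_
  refine flowAtT_of_safeTransport y T j' M (gate μ a)
    (fun l h => if (1 ≤ l ∧ 2 * (l : ℝ) < T ∧ h = t T l) then gate μ a l else 0)
    hy0 hy1 hTpos hj' g0 gM hta' (by rw [g1, gmean, mul_one]) ?_ ?_ ?_ ?_
  · intro l h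
    show (0:ℝ) ≤ (if (1 ≤ l ∧ 2 * (l : ℝ) < T ∧ h = t T l) then gate μ a l else 0)
    split_ifs
    · exact g0 l
    · exact le_rfl
  · intro l h hp
    change (0:ℝ) < (if (1 ≤ l ∧ 2 * (l : ℝ) < T ∧ h = t T l) then gate μ a l else 0) at hp
    split_ifs at hp with hc
    · obtain ⟨hl1, hlT, rfl⟩ := hc
      have hl0 : l ≠ 0 := by omega
      rw [gpos l hl0] at hp
      have hμl : 0 < μ l := pos_of_mul_pos_right hp ha0.le
      obtain ⟨hlt, htT, hTlt, _⟩ := hroute T hTpos hTle l hl1 hlT hμl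
      have htM : t T l ≤ M := by
        have : ((t T l : ℕ) : ℝ) < M := by linarith
        exact_mod_cast this.le
      refine ⟨hl1, hlT, hlt, htM, hTlt, ?_⟩
      have hd : (0 : ℝ) ≤ ((t T l : ℕ) : ℝ) - l := by
        have : (l : ℝ) ≤ (t T l : ℕ) := by exact_mod_cast hlt.le
        linarith
      calc y * (((t T l : ℕ) : ℝ) - l) ≤ 1 * (((t T l : ℕ) : ℝ) - l) := mul_le_mul_of_nonneg_right hy1.le hd
        _ ≤ T - l := by linarith
    · exact absurd hp (lt_irrefl _)
  · intro l hl1 hlT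
    have hl0 : l ≠ 0 := by omega
    have e : ∀ h, (if (1 ≤ l ∧ 2 * (l : ℝ) < T ∧ h = t T l) then gate μ a l else 0)
        = (if h = t T l then gate μ a l else 0) := fun h => by simp only [hl1, hlT, true_and]
    simp_rw [e]
    rw [Finset.sum_ite_eq']
    rcases (hμ0 l).eq_or_lt with hz | hpos
    · rw [gpos l hl0, ← hz, mul_zero]; split_ifs <;> rfl
    · obtain ⟨hlt, htT, _, _⟩ := hroute T hTpos hTle l hl1 hlT hpos
      have htM : t T l < M + 1 := by
        have : ((t T l : ℕ) : ℝ) < M + 1 := by linarith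
        exact_mod_cast this
      rw [if_pos (Finset.mem_range.2 htM)]
  · intro h hhM
    by_cases hex : ∃ l : ℕ, 1 ≤ l ∧ 2 * (l : ℝ) < T ∧ h = t T l ∧ 0 < μ l
    · obtain ⟨l₀, hl1, hlT, rfl, hμl⟩ := hex
      obtain ⟨hlt, htT, hTlt, hcap⟩ := hroute T hTpos hTle l₀ hl1 hlT hμl
      have hl₀M : l₀ ∈ Finset.range (M + 1) := by
        refine Finset.mem_range.2 ?_
        have : ((l₀ : ℕ) : ℝ) < M + 1 := by
          have : (l₀ : ℝ) < (t T l₀ : ℕ) := by exact_mod_cast hlt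
          linarith
        exact_mod_cast this
      rw [Finset.sum_eq_single_of_mem l₀ hl₀M]
      · simp only [hl1, hlT, true_and, if_true]
        have hd : (0 : ℝ) < ((t T l₀ : ℕ) : ℝ) - l₀ := by
          have : (l₀ : ℝ) < (t T l₀ : ℕ) := by exact_mod_cast hlt
          linarith
        set ρ : ℝ := (T - 2 * (l₀ : ℝ)) / (((t T l₀ : ℕ) : ℝ) - l₀) with hρ
        have hρ1 : ρ < 1 := by rw [hρ, div_lt_one hd]; linarith
        have hθ1 : max y ρ < 1 := max_lt hy1 hρ1
        have hS : 0 ≤ μ l₀ + μ (t T l₀) := add_nonneg (hμ0 _) (hμ0 _)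
        have h1 : max y ρ * (μ l₀ + μ (t T l₀)) ≤ μ (t T l₀) :=
          (mul_le_mul_of_nonneg_right (max_le_max hyx le_rfl) hS).trans hcap
        have ht0 : t T l₀ ≠ 0 := by omega
        have h2 : max y ρ * (gate μ a l₀ + gate μ a (t T l₀)) ≤ gate μ a (t T l₀) := by
          rw [gpos l₀ (by omega), gpos _ ht0]
          have := mul_le_mul_of_nonneg_left h1 ha0.le
          have e : max y ρ * (a * μ l₀ + a * μ (t T l₀)) = a * (max y ρ * (μ l₀ + μ (t T l₀))) := by ring
          rw [e]; exact this
        unfold freeRate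
        exact rate_mul_le' hθ1 h2
      · intro l hl hne
        split_ifs with hc
        · have hl0 : l ≠ 0 := by omega
          rcases (hμ0 l).eq_or_lt with hzl | hpos
          · rw [gpos l hl0, ← hzl, mul_zero, mul_zero]
          · exfalso
            exact hne (hinj T hTpos hTle l l₀ hc.1 hc.2.1 hpos hl1 hlT hμl hc.2.2.symm)
        · rw [mul_zero]
    · have hz : ∀ l ∈ Finset.range (M + 1),
          freeRate y T l h * (if (1 ≤ l ∧ 2 * (l : ℝ) < T ∧ h = t T l) then gate μ a l else 0) = 0 := by
        intro l _
        split_ifs with hc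
        · have hl0 : l ≠ 0 := by omega
          rcases (hμ0 l).eq_or_lt with hzl | hpos
          · rw [gpos l hl0, ← hzl, mul_zero, mul_zero]
          · exact absurd ⟨l, hc.1, hc.2.1, hc.2.2, hpos⟩ hex
        · rw [mul_zero]
      rw [Finset.sum_congr rfl hz, Finset.sum_const_zero]
      exact g0 h

/-! ### The progression criterion for the shape `(lo, K)` -/

/-- **THE PROGRESSION CRITERION FOR THE SHAPE `(lo, K)`** (`lo < K`, `2K ≤ 3lo`, width `j ≥ 2`): `μ` a probability law on `{0..(lo+K)j}` charging
only atoms `lo·j + K·s` (`s ≤ j`), mean `T₀ < (lo+K)j`, floor `0 < x < 1` with `x·(lo+K)j ≤ T₀`; `R ≥ 2` with `x(1+R) ≤ R`; ROUTE BOUND `R·μ l ≤ μ(l+Kr)`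
for every charged `l` with `2l < T₀` and every `r ≥ 1` with `2K(r−1) < 3(T₀ − 2l)`.  Then `SDEC x ((lo+K)j) μ`, by `sdec_of_nearRoutes_charged` with the
route map `l ↦ l + K⌈3(T−2l)/(2K)⌉`. [this work] -/
theorem sdec_progressionLK (lo K j : ℕ) (x T₀ R : ℝ) (μ : ℕ → ℝ) (hloK : lo < K) (hK : 2 * K ≤ 3 * lo) (hj : 2 ≤ j)
    (hx0 : 0 < x) (hx1 : x < 1)
    (hμ0 : ∀ h, 0 ≤ μ h) (hμM : ∀ h, (lo + K) * j < h → μ h = 0) (hμ1 : ∑ h ∈ Finset.range ((lo + K) * j + 1), μ h = 1)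
    (hT : ∑ h ∈ Finset.range ((lo + K) * j + 1), (h : ℝ) * μ h = T₀) (hT0 : 0 < T₀) (hTtop : T₀ < ((lo : ℝ) + K) * j)
    (hta : x * (((lo + K) * j : ℕ) : ℝ) ≤ T₀) (hsupp : ∀ h, μ h ≠ 0 → ∃ s, h = lo * j + K * s)
    (hR2 : 2 ≤ R) (hxR : x * (1 + R) ≤ R)
    (hbound : ∀ l r : ℕ, 1 ≤ l → 2 * (l : ℝ) < T₀ → 0 < μ l → 1 ≤ r → 2 * (K : ℝ) * ((r : ℝ) - 1) < 3 * (T₀ - 2 * (l : ℝ)) →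
      R * μ l ≤ μ (l + K * r)) :
    SDEC x ((lo + K) * j) μ := by
  have hK0 : (0 : ℝ) < K := by exact_mod_cast (lt_of_le_of_lt (Nat.zero_le lo) hloK)
  refine sdec_of_nearRoutes_charged x T₀ ((lo + K) * j) μ (fun T l => l + K * ⌈3 * (T - 2 * (l : ℝ)) / (2 * K)⌉₊) hx0 hx1 hμ0 hμM hμ1 hT hT0
    hta ?_ ?_
  · intro T hTpos hTle l hl1 hlT hμl
    obtain ⟨s, hs⟩ := hsupp l hμl.ne'
    have hlj : lo * j ≤ l := by rw [hs]; exact Nat.le_add_right _ _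
    have hljR : (lo : ℝ) * j ≤ l := by exact_mod_cast hlj
    have hj2 : (2 : ℝ) ≤ j := by exact_mod_cast hj
    have hK32 : 2 * (K : ℝ) ≤ 3 * lo := by exact_mod_cast hK
    set A : ℝ := 3 * (T - 2 * (l : ℝ)) / (2 * K) with hA
    have hA0 : 0 < A := by rw [hA]; exact div_pos (by linarith) (by linarith)
    set r : ℕ := ⌈A⌉₊ with hr
    have hrA : A ≤ r := Nat.le_ceil A
    have hrA1 : (r : ℝ) < A + 1 := Nat.ceil_lt_add_one hA0.le
    have hr1 : 1 ≤ r := Nat.ceil_pos.2 hA0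
    -- `K·r` against `D = T − 2l`
    have hKr_ge : 3 * (T - 2 * (l : ℝ)) / 2 ≤ K * r := by
      have : (K : ℝ) * A ≤ K * r := mul_le_mul_of_nonneg_left hrA hK0.le
      have e : (K : ℝ) * A = 3 * (T - 2 * (l : ℝ)) / 2 := by rw [hA]; field_simp
      linarith
    have hKr_lt : (K : ℝ) * r < 3 * (T - 2 * (l : ℝ)) / 2 + K := by
      have : (K : ℝ) * r < K * (A + 1) := mul_lt_mul_of_pos_left hrA1 hK0
      have e : (K : ℝ) * A = 3 * (T - 2 * (l : ℝ)) / 2 := by rw [hA]; field_simp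
      linarith
    -- nearness: `D ≤ 2l − 2K` from `l ≥ lo·j`, `T < (lo+K)j`, `(3lo − K)j ≥ 2K`
    have hD : T - 2 * (l : ℝ) < 2 * l - 2 * K := by
      have h1 : ((lo : ℝ) + K) * j + 2 * K ≤ 4 * ((lo : ℝ) * j) := by nlinarith
      linarith
    show l < l + K * r ∧ ((l + K * r : ℕ) : ℝ) < T ∧ T < (l : ℝ) + ((l + K * r : ℕ) : ℝ) ∧
      max x ((T - 2 * (l : ℝ)) / (((l + K * r : ℕ) : ℝ) - l)) * (μ l + μ (l + K * r)) ≤ μ (l + K * r)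
    have ec : ((l + K * r : ℕ) : ℝ) = (l : ℝ) + K * r := by push_cast; ring
    have hKr1 : 1 ≤ K * r := Nat.le_of_lt_succ (by nlinarith [hr1, hloK])
    refine ⟨by omega, ?_, ?_, ?_⟩
    · rw [ec]; linarith
    · rw [ec]; linarith
    · have ed : ((l + K * r : ℕ) : ℝ) - l = K * r := by rw [ec]; ring
      rw [ed]
      have hKr0 : (0 : ℝ) < K * r := by
        have : (1 : ℝ) ≤ r := by exact_mod_cast hr1
        nlinarith
      have hρ : (T - 2 * (l : ℝ)) / (K * r) ≤ 2 / 3 := by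
        rw [div_le_iff₀ hKr0]; linarith
      have hb : R * μ l ≤ μ (l + K * r) := by
        refine hbound l r hl1 (by linarith) hμl hr1 ?_
        have : 2 * (K : ℝ) * ((r : ℝ) - 1) < 2 * K * A := by nlinarith
        have e : 2 * (K : ℝ) * A = 3 * (T - 2 * (l : ℝ)) := by rw [hA]; field_simp
        linarith
      exact cap_of_routeBound hx0.le hR2 hxR hρ (hμ0 l) (hμ0 _) hb
  · -- injectivity on charged lows: along the progression the map shifts by `−2K` per step
    intro T hTpos hTle l l' hl1 hlT hμl hl1' hlT' hμl' heq
    obtain ⟨s, hs⟩ := hsupp l hμl.ne'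
    obtain ⟨s', hs'⟩ := hsupp l' hμl'.ne'
    -- the key computation: if `l' = l + K·d` then `⌈A⌉ = ⌈A'⌉ + 3d` and `t l' + 2Kd = t l`
    have key : ∀ (l₁ : ℕ) (d : ℕ), 2 * (((l₁ + K * d : ℕ) : ℝ)) < T →
        (l₁ + K * d) + K * ⌈3 * (T - 2 * (((l₁ + K * d : ℕ) : ℝ))) / (2 * K)⌉₊ + 2 * K * d
          = l₁ + K * ⌈3 * (T - 2 * (l₁ : ℝ)) / (2 * K)⌉₊ := by
      intro l₁ d hlow
      have ecast : ((l₁ + K * d : ℕ) : ℝ) = (l₁ : ℝ) + K * d := by push_cast; ring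
      have hA'0 : 0 ≤ 3 * (T - 2 * (((l₁ + K * d : ℕ) : ℝ))) / (2 * K) := div_nonneg (by linarith) (by linarith)
      have e : 3 * (T - 2 * (l₁ : ℝ)) / (2 * K) = 3 * (T - 2 * (((l₁ + K * d : ℕ) : ℝ))) / (2 * K) + ((3 * d : ℕ) : ℝ) := by
        rw [ecast]; push_cast; field_simp; ring
      rw [e, Nat.ceil_add_natCast hA'0]
      ring
    rcases lt_trichotomy s s' with h | h | h
    · exfalso
      obtain ⟨d, hd⟩ : ∃ d, s' = s + d + 1 := ⟨s' - s - 1, by omega⟩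
      have el' : l' = l + K * (d + 1) := by rw [hs', hs, hd]; ring
      have := key l (d + 1) (by rw [← el']; exact hlT')
      rw [← el'] at this
      have hpos : 0 < 2 * K * (d + 1) := Nat.mul_pos (Nat.mul_pos two_pos (by omega)) (Nat.succ_pos d)
      omega
    · subst h
      rw [hs, hs']
    · exfalso
      obtain ⟨d, hd⟩ : ∃ d, s = s' + d + 1 := ⟨s - s' - 1, by omega⟩
      have el : l = l' + K * (d + 1) := by rw [hs, hs', hd]; ring
      have := key l' (d + 1) (by rw [← el]; exact hlT)
      rw [← el] at this
      have hpos : 0 < 2 * K * (d + 1) := Nat.mul_pos (Nat.mul_pos two_pos (by omega)) (Nat.succ_pos d)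
      omega

end LawDec
end Quant
end Summit.CriticalPhenomena.PercolationContinuityZ3.Theorems
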